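import Summits.AtomisticToContinuum.BoseEinsteinCondensation.Theses.BECGroundStateSOS
import Summits.AtomisticToContinuum.BoseEinsteinCondensation.Theses.BECSectorPoincareTwoScale
import Summits.AtomisticToContinuum.BoseEinsteinCondensation.Theses.BECNoCheapMomentum
import Summits.AtomisticToContinuum.BoseEinsteinCondensation.Theorems.PeriodicIRBound.Negative.GroundOccupation
import Literature.MathematicalPhysics.QuantumManyBody.PeriodicBoseGasMomentumSector
import Literature.MathematicalPhysics.QuantumManyBody.PeriodicConfigFourier
import HarnessLib

/-!
# Route `BECGroundStateSOS`, crux `PeriodicIRBound` (stmt-AtomisticToContinuum-3972),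
# line `linear-ph-floor-wagner` — vocabulary and registered stub statements

`Defs` file of the crux line `linear-ph-floor-wagner`
(`Summits/AtomisticToContinuum/BoseEinsteinCondensation/Cruxes/PeriodicIRBound/Lines/linear-ph-floor-wagner.{md,lean}`,
idea card `…/Cruxes/PeriodicIRBound/Ideas/linear-ph-floor-wagner.md`, triage r1-1/2/3: pass; picked by the lead,
`…/Cruxes/PeriodicIRBound/PICKED.md`). A `Cruxes/…/Lines/*.lean` skeleton is not an importable module, so the
objects the line posits and the STATEMENTS of its registered stubs live here, to be imported verbatim by the stub
files `Theorems/BECGroundStateSOSPeriodicIRBound<Stub>.lean` (landed `--supports stmt-AtomisticToContinuum-3972`)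
and by the closing composition `PeriodicIRBound_of` of the skeleton. Contents:

* the per-potential dictionary over tree declarations (`periodicGroundStateEnergy`, `momentumSectorEnergy`,
  `sideLength`, `groundOccupation`, `GroundIRBoundWith`, `IRBoundFor`): `LinearFloorFor` (the LINEAR
  particle–hole sector floor `C⁺` for one potential), `LinearParticleHoleFloor` (global `C⁺`),
  `ZeroMomentumGapFor` (body of stmt-AtomisticToContinuum-11845 per potential, `zeroMomentumGround_iff : Iff.rfl`),
  `GroundIRBoundFor` (the crux per potential in γ-form, `groundIRBoundFor_iff`);
* the vocabulary of stub 5b's proof plan (sub-namespace `WF`: `qform`, `normSq`, `IsSymm`, `IsCore`, `formRe`,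
  `innerRe`, `comProj` — unnormalised energy form, symmetric periodic core, real polarised form, centre-of-mass
  projection);
* the proved pooling lemma `sectorGapFloor_of_linearParticleHoleFloor : C⁺ → BECNoCheapMomentum.SectorGapFloor`
  (stmt-AtomisticToContinuum-11843);
* the statements of the line's OWN stubs as named, deliberately untagged `Prop`s (statements of a proof plan, not
  results in print; the audit's advisory `vendored-fact` class is expected until the stub files provide witnesses):
  `LinearFloorOfLandau` (stub 4: stmt-9094 → stmt-9091 → `C⁺`), `WagnerFeynmanWith`/`WagnerFeynmanBound`
  (stub 5b: the Wagner–Feynman two-sided moment bound for the ground-state occupations at fixed `(N, L)`, held by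
  the lead), `TransferArith` (stub 5c: window arithmetic + the a.e.-free case), `Transfer` (the integrable half,
  `transfer_of : WagnerFeynmanBound → TransferArith → Transfer`), `HardCoreWagnerFeynmanWith`/`HardCoreWagnerFeynmanBound`
  (stub 6b: the dressed moment bound for non-integrable `v`, the line's fragile content), `HardCoreHalf` (stub 6: the
  non-integrable half's window arithmetic).
  The three POOLED stubs are the sibling items themselves (`BECSectorPoincareTwoScale.LandauSectorBound` =
  stmt-9091, `BECSectorPoincareTwoScale.EnergyConvexityWindow` = stmt-9094, `BECNoCheapMomentum.ZeroMomentumGround`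
  = stmt-11845) and need no new name.

References: H. Wagner, Z. Physik 195 (1966) 273 (two-sided Bogoliubov/moment inequality); S. Stringari, in
*Bose–Einstein Condensation* (Griffin–Snoke–Stringari eds., CUP 1995) §2.2 (16); L. Pitaevskii, S. Stringari,
J. Low Temp. Phys. 85 (1991) 377; H. D. Cornean, J. Dereziński, P. Ziń, J. Math. Phys. 50 (2009) 062103 §1.1, §2.7
(`inf sp H(k)`, non-degenerate torus ground state); LSSY2005 App. C (scattering length).
-/

noncomputable section

open scoped BigOperators ENNReal
open Filter MeasureTheory

namespace Summit.AtomisticToContinuum.BoseEinsteinCondensation.Cruxes.PeriodicIRBound.LinearPhFloorWagner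

open Literature.MathematicalPhysics.QuantumManyBody.BoseGas
open Summit.AtomisticToContinuum.BoseEinsteinCondensation.Theses.BECGroundStateSOS (PeriodicIRBound)
open Summit.AtomisticToContinuum.BoseEinsteinCondensation.Theses.BECSectorPoincareTwoScale
  (LandauSectorBound EnergyConvexityWindow)
open Summit.AtomisticToContinuum.BoseEinsteinCondensation.Theses.BECNoCheapMomentum
  (ZeroMomentumGround SectorGapFloor)
open Summit.AtomisticToContinuum.BoseEinsteinCondensation.Theorems.PeriodicIRBound.Negative
  (IRBoundFor InWindow groundOccupation GroundIRBoundWith irBoundFor_iff_ground)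

/-! ## §1 The transfer target `C⁺` and the per-potential dictionary -/

/-- **`C⁺` for one potential (LINEAR particle–hole sector floor).** For every window constant `C > 0` there
are `θ, ρ₀ > 0` with: for `0 < ρ < ρ₀`, eventually in `N`, for every `k ≠ 0` with `‖k‖² ≤ Cρ`,
`2E₀^per(N,L_N) + 2θ√ρ‖k‖ ≤ E^per_{N+1}(k;L_N) + E^per_{N-1}(k;L_N)`, `L_N = (N/ρ)^{1/3}`,
`E^per_M(k;L) = momentumSectorEnergy v M L k` (`⊤` off the dual lattice `(2π/L_N)ℤ³`, so only lattice momenta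
bind). Verbatim the tail of `BECNoCheapMomentum.SectorGapFloor` (stmt-11843) with the quadratic floor `2κ‖k‖²`
replaced by the linear `2θ√ρ‖k‖` — the weakest floor giving the crux's exponent `1`; `θ = θ(v)` absorbs `√a`.
FALSE for the a.e.-free gas (`Γ_free = 2|k|² + O(1/NL²)`), whence the hypothesis `∫v ≠ 0` in
`LinearParticleHoleFloor`. A statement of the proof plan, not a result in print. -/
def LinearFloorFor (v : ℝ → ℝ≥0∞) : Prop :=
  ∀ C : ℝ, 0 < C → ∃ θ : ℝ, 0 < θ ∧ ∃ ρ₀ : ℝ, 0 < ρ₀ ∧ ∀ ρ : ℝ, 0 < ρ → ρ < ρ₀ →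
    ∀ᶠ N : ℕ in atTop, ∀ k : Space, k ≠ 0 → ‖k‖ ^ 2 ≤ C * ρ →
      2 * periodicGroundStateEnergy v N (sideLength ρ N) +
          ENNReal.ofReal (2 * θ * Real.sqrt ρ * ‖k‖) ≤
        momentumSectorEnergy v (N + 1) (sideLength ρ N) k +
          momentumSectorEnergy v (N - 1) (sideLength ρ N) k

/-- **Global `C⁺`**: the linear particle–hole floor for every repulsive finite-range `v` that is not a.e. zero
(`∫ v(|x|) dx ≠ 0`; hard cores `∫v = ⊤` INCLUDED). By `LinearFloorOfLandau` (stub 4) it follows from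
stmt-9091 ∧ stmt-9094, and by `sectorGapFloor_of_linearParticleHoleFloor` it implies stmt-11843. A statement of the
proof plan (conjecture-level), not a result in print. -/
def LinearParticleHoleFloor : Prop :=
  ∀ v : ℝ → ℝ≥0∞, IsRepulsiveFiniteRange v → (∫⁻ x : Space, v ‖x‖) ≠ 0 → LinearFloorFor v

/-- **Zero-momentum gap at fixed `(N, L)`** for one potential: `E₀^per(N,L) < E^per_N(q;L)` for every `q ≠ 0`
(Perron–Frobenius uniqueness/positivity of the torus ground state). `BECNoCheapMomentum.ZeroMomentumGround`
(stmt-11845) is `∀ v` integrable, `ZeroMomentumGapFor v` — definitionally (`zeroMomentumGround_iff`).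
[cite: CorneanDerezinskiZin2009, §2.7] -/
def ZeroMomentumGapFor (v : ℝ → ℝ≥0∞) : Prop :=
  ∀ (N : ℕ) (L : ℝ), 0 < L → ∀ q : Space, q ≠ 0 →
    periodicGroundStateEnergy v N L < momentumSectorEnergy v N L q

/-- **The crux for one potential in γ-form** (Disproof §11, landed `Negative.GroundOccupation`): for every `κ > 0`
there are `ρ₀, C > 0` with `groundOccupation v N L_N k ≤ C√ρ L_N/‖k‖_∞` for all `k` in the window, eventually in
`N`, for all `ρ < ρ₀` — no slack `δ`, no state quantifier. Equivalent to the crux's `IRBoundFor v` by the landed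
`irBoundFor_iff_ground` (`groundIRBoundFor_iff`). [folklore] -/
def GroundIRBoundFor (v : ℝ → ℝ≥0∞) : Prop :=
  ∀ κ : ℝ, 0 < κ → ∃ ρ₀ : ℝ, 0 < ρ₀ ∧ ∃ C : ℝ, 0 < C ∧ GroundIRBoundWith v κ ρ₀ C

/-- γ-form ↔ crux form, per potential (landed `irBoundFor_iff_ground`). [folklore] -/
theorem groundIRBoundFor_iff (v : ℝ → ℝ≥0∞) : GroundIRBoundFor v ↔ IRBoundFor v :=
  (irBoundFor_iff_ground v).symm

/-- stmt-11845 is, definitionally, `ZeroMomentumGapFor` for every integrable admissible `v`. [folklore] -/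
theorem zeroMomentumGround_iff :
    ZeroMomentumGround ↔ ∀ v : ℝ → ℝ≥0∞, IsRepulsiveFiniteRange v → (∫⁻ x : Space, v ‖x‖) ≠ ⊤ →
      ZeroMomentumGapFor v :=
  Iff.rfl

/-- **Pooling lemma: `C⁺` implies BECNoCheapMomentum's rank-2 crux `SectorGapFloor` (stmt-11843).**
On the window `‖k‖² ≤ Cρ` one has `‖k‖ ≤ √C·√ρ`, so the linear floor `2θ√ρ‖k‖` dominates the quadratic one
`2κ‖k‖²` with `κ := θ/√C`. [folklore] -/
theorem sectorGapFloor_of_linearParticleHoleFloor (h : LinearParticleHoleFloor) : SectorGapFloor := by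
  intro v hv hv0 C hC
  obtain ⟨θ, hθ, ρ₀, hρ₀, hθρ⟩ := h v hv hv0 C hC
  have hCpos : 0 < Real.sqrt C := Real.sqrt_pos.2 hC
  refine ⟨θ / Real.sqrt C, div_pos hθ hCpos, ρ₀, hρ₀, fun ρ hρ hρρ₀ => ?_⟩
  filter_upwards [hθρ ρ hρ hρρ₀] with N hN k hk hkC
  refine le_trans ?_ (hN k hk hkC)
  have hkn : 0 ≤ ‖k‖ := norm_nonneg k
  have hk' : ‖k‖ ≤ Real.sqrt C * Real.sqrt ρ := by
    rw [← Real.sqrt_mul hC.le, ← Real.sqrt_sq hkn]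
    exact Real.sqrt_le_sqrt hkC
  have key : 2 * (θ / Real.sqrt C) * ‖k‖ ^ 2 ≤ 2 * θ * Real.sqrt ρ * ‖k‖ :=
    calc 2 * (θ / Real.sqrt C) * ‖k‖ ^ 2
        = 2 * (θ / Real.sqrt C) * ‖k‖ * ‖k‖ := by ring
      _ ≤ 2 * (θ / Real.sqrt C) * (Real.sqrt C * Real.sqrt ρ) * ‖k‖ := by gcongr
      _ = 2 * θ * Real.sqrt ρ * ‖k‖ := by field_simp
  exact add_le_add le_rfl (ENNReal.ofReal_le_ofReal key)

/-- **Registered sub-goal `stub_poolingSectorGapFloor`** (by-product of the line, `ledger workitem stub-add`): `C⁺` closes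
BECNoCheapMomentum's rank-2 crux `SectorGapFloor` (stmt-AtomisticToContinuum-11843). [folklore] -/
theorem stub_poolingSectorGapFloor : LinearParticleHoleFloor → SectorGapFloor :=
  sectorGapFloor_of_linearParticleHoleFloor

/-! ## §2 Statements of the line's own stubs -/

/-- **Stub 4 statement — `EnergyConvexityWindow → LandauSectorBound → C⁺`** (the linear twin of the filed
support item `BECSectorPoincareTwoScale.LandauFloorToSectorGap`, stmt-9096). Plan: for admissible `v` with
`∫v ≠ 0`, `a := scatteringLength v` has `0 < a.toReal` (`LSSY2005_zeroScatteringLength_holds` contrapositive,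
`scatteringLength_ne_top_of_finiteRange`); apply stmt-9091 with `M₀ := √(C/a)` at particle numbers `N ± 1` in the
same box `L_N` (density window for `N ≥ 2`), off-lattice `k` give `⊤` (`momentumSectorEnergy_eq_top_of_forall_ne`),
absorb the convexity allowance with `ε := πθ` via `‖k‖ ≥ 2π/L_N`; output `θ' = (3/4)θ√a`. A statement of the
proof plan, not a result in print. -/
def LinearFloorOfLandau : Prop :=
  EnergyConvexityWindow → LandauSectorBound → LinearParticleHoleFloor

/-- **The Wagner–Feynman moment bound with constant `A`, for one potential, at fixed `(N, L)`**: whenever the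
particle–hole sector sum at the dual-lattice momentum `p = 2πk/L` exceeds `2E₀^per(N,L)` by `θ ≥ 0`, the
ground-state occupation `γ_N(k)` (`groundOccupation`, `⨅_δ ⨆_{δ-near-min}`) obeys
`γ_N(k)·θ ≤ A(‖p‖² + N‖v‖₁/L³)`, `‖v‖₁ = ∫ v(|x|)dx` — the two-sided moment inequality
`n_p Γ_N(p) ≤ ⟨[[a_p,H],a_p†]⟩ = ‖p‖² + L⁻³(v̂(0)N + ∑_q v̂(q-p)n_q) ≤ ‖p‖² + 2N‖v‖₁/L³` for the zero-momentum
part of near-minimisers (`δ → 0` through the zero-momentum gap); Wagner (1966), Stringari (1995) §2.2 (16). A statement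
of the proof plan, not a result in print. -/
def WagnerFeynmanWith (v : ℝ → ℝ≥0∞) (A : ℝ) : Prop :=
  ∀ (N : ℕ) (L : ℝ), 2 ≤ N → 0 < L → periodicGroundStateEnergy v N L ≠ ⊤ →
    ∀ k : Fin 3 → ℤ, k ≠ 0 → ∀ θ : ℝ, 0 ≤ θ →
      2 * periodicGroundStateEnergy v N L + ENNReal.ofReal θ ≤
          momentumSectorEnergy v (N + 1) L (latticeVec (2 * Real.pi / L) k) +
            momentumSectorEnergy v (N - 1) L (latticeVec (2 * Real.pi / L) k) →
      groundOccupation v N L k * ENNReal.ofReal θ ≤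
        ENNReal.ofReal (A * (‖latticeVec (2 * Real.pi / L) k‖ ^ 2 +
          N * (∫⁻ x : Space, v ‖x‖).toReal / L ^ 3))

/-- **Stub 5b statement — the Wagner–Feynman bound** (the line's analytic heart, held by the lead): one absolute
constant `A` serves every INTEGRABLE admissible `v` with the fixed-`(N,L)` zero-momentum gap. Plan: c.o.m. sector
decomposition of a `δ`-near-minimiser (`∑_{q≠0}‖Ψ_q‖² ≤ δ/g_N`, `g_N > 0` from `ZeroMomentumGapFor` and
`E_N(q) ≥ |q|²/N`), first-quantised `a(φ_p)`, `a†(φ_p)` on the zero-momentum part `Φ`, sector variational bounds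
(`momentumSectorEnergy_neg`, `E₀(N) ≤ E₀(N+1)`), the form identity
`Q_{N-1}(aΦ) + Q_{N+1}(a†Φ) = ⟨[[a,H],a†]⟩_Φ + 2Re B(n̂_pΦ,Φ) + Q_N(Φ)` with `|2Re B₀(n̂_pΦ,Φ)| ≤ 2√(δ'K)`,
`K < ∞` because `v ∈ L¹`; `δ → 0` (Wagner 1966; Pitaevskii–Stringari 1991). A statement of the proof plan, not a result in
print. -/
def WagnerFeynmanBound : Prop :=
  ∃ A : ℝ, 0 < A ∧ ∀ v : ℝ → ℝ≥0∞, IsRepulsiveFiniteRange v → (∫⁻ x : Space, v ‖x‖) ≠ ⊤ →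
    ZeroMomentumGapFor v → WagnerFeynmanWith v A

/-- **Stub 5c statement — window arithmetic and the a.e.-free case**: for an integrable admissible `v`, `C⁺`
(when `∫v ≠ 0`) and a Wagner–Feynman bound with some constant `A` give the crux for `v` in γ-form. Plan:
(i) `∫v = 0`: `v(|·|) = 0` a.e., `periodicEnergy v = periodicEnergy 0` (tree: `periodicEnergy_eq_ofReal_of_ae`),
so `IRBoundFor v ↔ IRBoundFor 0`, true by the landed `irBoundFor_zero`; (ii) `∫v ≠ 0`: fix `κ`; window modes
have `p = 2πk/L_N` with `‖p‖² ≤ 12π²κ²ρ` and `‖p‖ ≥ 2π‖k‖_∞/L_N`; take the floor at `C := 12π²κ²`,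
`ρ₀ := min(ρ₀^floor, ρ₁^Ruelle)` (`exists_eventually_periodicGroundStateEnergy_lt_top`), `θ := 2θ₀√ρ‖p‖`, and
`γ ≤ A(‖p‖² + ρ‖v‖₁)/(2θ₀√ρ‖p‖) ≤ A(π√3κ² + ‖v‖₁/(4π))/θ₀ · √ρL_N/‖k‖_∞` (`L_N³ = N/ρ`,
`1 ≤ κ√ρL_N/‖k‖_∞`). Elementary. -/
def TransferArith : Prop :=
  ∀ v : ℝ → ℝ≥0∞, IsRepulsiveFiniteRange v → (∫⁻ x : Space, v ‖x‖) ≠ ⊤ →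
    ((∫⁻ x : Space, v ‖x‖) ≠ 0 → LinearFloorFor v) →
    (∃ A : ℝ, 0 < A ∧ WagnerFeynmanWith v A) → GroundIRBoundFor v

/-- **The integrable half of the crux** (the card's `stub_transfer`): for an INTEGRABLE admissible `v`, `C⁺` for
`v` (available when `∫v ≠ 0`) and the fixed-`(N,L)` zero-momentum gap give the crux for `v` in γ-form. Derived
from stubs 5b and 5c by `transfer_of`. -/
def Transfer : Prop :=
  ∀ v : ℝ → ℝ≥0∞, IsRepulsiveFiniteRange v → (∫⁻ x : Space, v ‖x‖) ≠ ⊤ →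
    ((∫⁻ x : Space, v ‖x‖) ≠ 0 → LinearFloorFor v) → ZeroMomentumGapFor v → GroundIRBoundFor v

/-- `WagnerFeynmanBound → TransferArith → Transfer` (pure logic). [folklore] -/
theorem transfer_of (h₁ : WagnerFeynmanBound) (h₂ : TransferArith) : Transfer := by
  intro v hv hint hfloor hzmg
  obtain ⟨A, hA, h⟩ := h₁
  exact h₂ v hv hint hfloor ⟨A, hA, h v hv hint hzmg⟩

/-- **The hard-core (Jastrow/Dyson-dressed) Wagner–Feynman moment bound with window constant `C`, moment
constant `A` and density threshold `ρ₁`, for one potential, along the thermodynamic boxes `L_N = (N/ρ)^{1/3}`**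
(shape proposed by the stub-6 worker, wave 1): for `0 < ρ < ρ₁`, eventually in `N`, for every dual-lattice momentum
`p = 2πk/L_N`, `k ≠ 0`, with `‖p‖² ≤ Cρ`: whenever the particle–hole sector sum at `p` exceeds `2E₀^per(N,L_N)` by
`θ ≥ 0`, the ground-state occupation obeys `γ_N(k)·θ ≤ A(‖p‖² + ρ)` — the `∫v = ⊤` twin of `WagnerFeynmanWith v A`
(whose constant `N‖v‖₁/L³` is void for hard cores): the conclusion of the PER-MODE dressed chain
`n_pΓ_N(p) ≲ ⟨[ã_p,[H,ã_p†]]⟩ ≤ C'(‖p‖²(1 + ρR³) + ρa)`, `ã_p† = a†(φ_p ∏_j f(· − x_j))`, INCLUDING the per-mode undressing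
and the low-density zero-momentum gap for hard cores. Stated along `L_N` at low density and on the window only
(jammed hard-core boxes have empty finite-energy sectors; `ZeroMomentumGapFor hardCore` is false as an `∀ L`
statement). A statement of the proof plan, not a result in print. -/
def HardCoreWagnerFeynmanWith (v : ℝ → ℝ≥0∞) (C A ρ₁ : ℝ) : Prop :=
  ∀ ρ : ℝ, 0 < ρ → ρ < ρ₁ → ∀ᶠ N : ℕ in atTop, ∀ k : Fin 3 → ℤ, k ≠ 0 →
    ‖latticeVec (2 * Real.pi / sideLength ρ N) k‖ ^ 2 ≤ C * ρ → ∀ θ : ℝ, 0 ≤ θ →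
      2 * periodicGroundStateEnergy v N (sideLength ρ N) + ENNReal.ofReal θ ≤
          momentumSectorEnergy v (N + 1) (sideLength ρ N) (latticeVec (2 * Real.pi / sideLength ρ N) k) +
            momentumSectorEnergy v (N - 1) (sideLength ρ N) (latticeVec (2 * Real.pi / sideLength ρ N) k) →
      groundOccupation v N (sideLength ρ N) k * ENNReal.ofReal θ ≤
        ENNReal.ofReal (A * (‖latticeVec (2 * Real.pi / sideLength ρ N) k‖ ^ 2 + ρ))

/-- **Stub 6b statement — the hard-core moment bound** (the non-integrable half's ANALYTIC input; L/XL, the line's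
fragile content): for every NON-INTEGRABLE admissible `v` and every window constant `C` there are `A, ρ₁` with
`HardCoreWagnerFeynmanWith v C A ρ₁`. Missing inputs identified by the stub-6 worker (wave 1): (α) a dressed 3-body
double-commutator estimate uniform in `N` (cf. stmt-AtomisticToContinuum-11844, which is mode-COUNTING only);
(β) the low-density zero-momentum gap for hard cores (stmt-11845 assumes `∫v < ∞`); (γ) a per-mode 4-point undressing
bound (a bounded structure factor on the window controls only the coherent piece). A statement of the proof plan,
not a result in print. -/
def HardCoreWagnerFeynmanBound : Prop :=
  ∀ v : ℝ → ℝ≥0∞, IsRepulsiveFiniteRange v → (∫⁻ x : Space, v ‖x‖) = ⊤ →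
    ∀ C : ℝ, 0 < C → ∃ A : ℝ, 0 < A ∧ ∃ ρ₁ : ℝ, 0 < ρ₁ ∧ HardCoreWagnerFeynmanWith v C A ρ₁

/-- **Stub 6 statement — the NON-INTEGRABLE half** (`∫v = ⊤`: hard cores, non-`L¹` spikes; Disproof §19
`hardCore_in_scope`), as RESHAPED by the lead after wave 1: `C⁺` for `v` and the hard-core moment bound (stub 6b's
shape, for every window constant) give the crux for `v` in γ-form — window arithmetic, the `∫v = ⊤` twin of
`TransferArith` (provable now). -/
def HardCoreHalf : Prop :=
  ∀ v : ℝ → ℝ≥0∞, IsRepulsiveFiniteRange v → (∫⁻ x : Space, v ‖x‖) = ⊤ →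
    (∀ C : ℝ, 0 < C → ∃ A : ℝ, 0 < A ∧ ∃ ρ₁ : ℝ, 0 < ρ₁ ∧ HardCoreWagnerFeynmanWith v C A ρ₁) →
    LinearFloorFor v → GroundIRBoundFor v

/-! ## §2b Vocabulary of stub 5b (`stub_wagnerFeynman`): unnormalised forms, the symmetric periodic core,
the real polarised form, the centre-of-mass projection

Objects of the lead's proof plan for `WagnerFeynmanBound` (first-quantised Wagner–Feynman chain), shared by its
helper files `Theorems/BECGroundStateSOSPeriodicIRBoundWF*.lean`; all over tree declarations (`kineticDensity`,
`periodicInteraction`, `cellN`, `IsTorusPeriodic`). -/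

namespace WF

variable {M : ℕ}

/-- The UNNORMALISED energy form `𝓔_w[f] = ∫_{[0,L)^{3M}} (|∇f|² + W|f|²)`, `W = ∑_{i<j} w^per(xᵢ - xⱼ)`, in
`ℝ≥0∞` (so that `periodicEnergy w Ψ = qform w L Ψ.ψ` definitionally, `periodicEnergy_eq_qform`).
[cite: Fournais2020, (1.1)] -/
def qform (w : ℝ → ℝ≥0∞) (L : ℝ) (f : Config M → ℂ) : ℝ≥0∞ :=
  ∫⁻ X in cellN M L, (kineticDensity f X + periodicInteraction w L X * ((‖f X‖₊ : ℝ≥0∞)) ^ 2)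

/-- `‖f‖²_{[0,L)^{3M}}` in `ℝ≥0∞`. [folklore] -/
def normSq (L : ℝ) (f : Config M → ℂ) : ℝ≥0∞ :=
  ∫⁻ X in cellN M L, ((‖f X‖₊ : ℝ≥0∞)) ^ 2

/-- Bose symmetry of an `M`-body function. [folklore] -/
def IsSymm (f : Config M → ℂ) : Prop :=
  ∀ (σ : Equiv.Perm (Fin M)) (X : Config M), f (X ∘ σ) = f X

/-- The admissible UNNORMALISED functions (the form core underlying `PeriodicTrialState`): `C¹`,
`Lℤ³`-periodic in every particle, Bose-symmetric. [cite: Fournais2020, (1.1)–(1.2)] -/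
structure IsCore (L : ℝ) (f : Config M → ℂ) : Prop where
  /-- `f` is `C¹`. -/
  contDiff : ContDiff ℝ 1 f
  /-- `f` is `Lℤ³`-periodic in every particle. -/
  periodic : IsTorusPeriodic L f
  /-- `f` is Bose-symmetric. -/
  symm : IsSymm f

/-- `periodicEnergy w Ψ = 𝓔_w[Ψ.ψ]`. [folklore] -/
theorem periodicEnergy_eq_qform {L : ℝ} (w : ℝ → ℝ≥0∞) (Ψ : PeriodicTrialState M L) :
    periodicEnergy w Ψ = qform w L Ψ.ψ := rfl

/-- The function of a periodic trial state is a core function. [folklore] -/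
theorem isCore_trialState {L : ℝ} (Ψ : PeriodicTrialState M L) : IsCore L Ψ.ψ :=
  ⟨Ψ.contDiff, Ψ.periodic, Ψ.symm⟩

/-- The real part of the polarised energy form, `Re B_w(f,g) = ∫ (Re(∇f̄·∇g) + W Re(f̄ g))` (Bochner integral;
meaningful when `𝓔_w[f], 𝓔_w[g] < ∞`): `𝓔_w[f + tg] = 𝓔_w[f] + 2t Re B_w(f,g) + t²𝓔_w[g]` for real `t`. [folklore] -/
def formRe (w : ℝ → ℝ≥0∞) (L : ℝ) (f g : Config M → ℂ) : ℝ :=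
  ∫ X in cellN M L, ((∑ i : Fin M, ∑ c : Fin 3,
      ((starRingEnd ℂ) (fderiv ℝ f X (Pi.single i (EuclideanSpace.single c (1 : ℝ)))) *
        fderiv ℝ g X (Pi.single i (EuclideanSpace.single c (1 : ℝ)))).re) +
    (periodicInteraction w L X).toReal * ((starRingEnd ℂ) (f X) * g X).re)

/-- `Re⟨f, g⟩_{[0,L)^{3M}}`. [folklore] -/
def innerRe (L : ℝ) (f g : Config M → ℂ) : ℝ :=
  (∫ X in cellN M L, (starRingEnd ℂ) (f X) * g X).re

/-- The **centre-of-mass projection** onto total momentum `0`: `(PΨ)(X) = L⁻³ ∫_{s ∈ [0,L)³} Ψ(x₁+s, …, x_M+s) ds`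
(the average over simultaneous translations of all particles; for periodic `Ψ` the integrand is `Lℤ³`-periodic
in `s`). [cite: CorneanDerezinskiZin2009, §1.1] -/
def comProj (L : ℝ) (Ψ : Config M → ℂ) (X : Config M) : ℂ :=
  (((L ^ 3)⁻¹ : ℝ) : ℂ) * ∫ s in cell L, Ψ (fun i => X i + s)

end WF

/-! ## §3 The composition shape (sorry-free; the skeleton instantiates it with the registered stubs) -/

/-- **`PeriodicIRBound` from the line's inputs**: the three pooled items (stmt-9094, stmt-9091, stmt-11845) and
the line's own five statements give the crux BY NAME — unfold to `∀ v admissible, IRBoundFor v`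
(`periodicIRBound_iff`), pass to γ-form (`irBoundFor_iff_ground`), split on `∫v = ⊤`. [folklore] -/
theorem periodicIRBound_of_inputs (h₁ : LandauSectorBound) (h₂ : EnergyConvexityWindow)
    (h₃ : ZeroMomentumGround) (h₄ : LinearFloorOfLandau) (h₅ : WagnerFeynmanBound) (h₆ : TransferArith)
    (h₇ : HardCoreHalf) (h₈ : HardCoreWagnerFeynmanBound) : PeriodicIRBound := by
  have hFloor : LinearParticleHoleFloor := h₄ h₂ h₁
  have hT : Transfer := transfer_of h₅ h₆
  refine Summit.AtomisticToContinuum.BoseEinsteinCondensation.Theorems.PeriodicIRBound.Negative.periodicIRBound_iff.2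
    fun v hv => (irBoundFor_iff_ground v).2 ?_
  by_cases htop : (∫⁻ x : Space, v ‖x‖) = ⊤
  · exact h₇ v hv htop (h₈ v hv htop) (hFloor v hv (ne_of_eq_of_ne htop ENNReal.top_ne_zero))
  · exact hT v hv htop (hFloor v hv) (fun N L hL q hq => h₃ v hv htop N L hL q hq)

end Summit.AtomisticToContinuum.BoseEinsteinCondensation.Cruxes.PeriodicIRBound.LinearPhFloorWagner

end
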